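import Summits.Ventures.Crystal3D.Bulk.FamcertCharts
import HarnessLib

/-!
# The placement plan of `fs4` (A lineage, stage 2) in the kernel: the `SO(3)` gauge «first ball at
# the pole, second in the half-plane `y = 0`», the trilateration formulas and anchor clamps of
# `trilat`, the cosine-parametrised circle of one-anchored vertices, and the mirror — the geometric
# core of the A-internal premise «the plan COVERS every solution modulo `O(3)`»

HONEST FRAMING. Part of the venture `Summits/Ventures/Crystal3D` (cell `pub-crystal3d`, phase 2;
seat p2, PROMOTION-AUDIT prep). Elementary linear algebra in `ℝ³` on top of `Bulk/LinkCharts.lean`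
and `Bulk/FamcertCharts.lean`; nothing here asserts anything about GAP(1.26), books or replays a
kill, or moves a census number. Purpose (A-family dossier
`phase2/ENV-CENSUS/impla/audit-prep-g8/A-FAMILY-AUDIT-DOSSIER-engine4-g8.md` §2.3 + F-A5; p2 lane
note `phase2/p2-rows/g16/A-ROWS-STATUS-p2-g16.md` §2): `fs4` (`src/fs4.c` sha256:16
`f3a05d5b1ce43ad4`; closed pass REFUTED / IRR pass REFUTED-IRR) refutes the closed relaxation of a
cell by interval branch-and-prune over a PLACEMENT PLAN (`make_plan` l.174–219, `evaluate`
l.318–395, `trilat` l.274–313, `frame` l.247–261, branches l.594–615): ball `p₀` at `(0, 0, 1)`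
(kind 0), `p₁` at `(√(1 − t²), 0, t)` (kind 1, `t` = the pair's target `1/2` or the hole parameter),
two-anchored balls by `trilat` with a branch sign (kind 2), one-anchored balls on a circle with
parameter `c ∈ [−1, 1]` and a sign (kind 3), the first branching quotiented by the mirror `y ↦ −y`.
Its ONE structural premise beyond the rows is «the plan COVERS every solution modulo `O(3)`»
(dossier §2.3: «argued in the file header / DESIGN.md §4, tested by the controls of §5, not refereed
line by line»). THIS file proves the geometric steps as kernel theorems, in the code's coordinates:

* §1 **right-handed orthonormal frames**: `frame_expand` (`v = Σ (rᵢ·v) rᵢ`), `frame_dot` /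
  `frame_cross` (the coordinate map `v ↦ (r₁·v, r₂·v, r₃·v)` preserves dot and cross products — so
  every row, a dot product or a triple product, is invariant), **`gauge_pole`** (every unit `u` is
  the third vector of such a frame: some proper rotation takes `u` to `(0, 0, 1)`) and
  **`fs4_gauge`** (kinds 0 + 1: unit `u₀, u₁` with `u₁·u₀ = t`, `t² < 1` are carried by a frame map
  followed by a rotation about `e₃` (`Bulk/FamcertCharts.lean`) to `(0,0,1)` and `(√(1 − t²), 0, t)`);
  this is also the `p = e₃` convention of famcert and LINK;
* §2 **`fs4_trilat_xx`** (l.288–297: `alpha = ½/(1+μ)`, `γ² = (1+2μ)/(2(1+μ)²(1−μ))`,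
  `P = alpha (A+B) + γ (A×B)`) and **`fs4_trilat`** (l.298–311: `α = (t_a − μ t_b)/(1−μ²)`,
  `β = (t_b − μ t_a)/(1−μ²)`, `q = α² + β² + 2αβμ`, `γ² = (1 − q)/(1 − μ²)`,
  `P = α A + β B + γ (A×B)`): every unit `P` with the two targets is reached by one of the two signs;
  **`fs4_clamp_xx`** (l.276–281: two x-anchors of a common x-neighbour have `−1/2 ≤ μ`; the upper
  clamp `μ ≤ 1/2` is a row) and **`fs4_clamp_px`**, **`fs4_clamp_px_mono`** (l.282–286 / l.712:
  `g_mulo_px = t_lo/2 − √(1 − t_lo²)·√3/2 ≤ p·B` for an x-anchor `B` of a ball at hole level `t ≥ t_lo`);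
* §3 **`fs4_frame_y`** (l.251–253: `E1 = (−A_z, 0, A_x)/√(A_x² + A_z²)` is a unit vector `⊥ A`; the
  `ẑ` frame l.254–256 is `famcert_ROT_frame`) and **`fs4_circle_chart`** (kind 3, l.369–380: a unit
  `X` with `X·A = t`, `t² < 1`, is `t A + √(1−t²)(c E1 + s (A × E1))` with `c ∈ [−1, 1]`,
  `s = ±√(1 − c²)`);
* the mirror `y ↦ −y` preserves dots, negates triple products and fixes both gauge points:
  `famcert_mirror_dot` / `famcert_mirror_triple` / `famcert_mirror_gauge` (`Bulk/FamcertCharts.lean`).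

What stays OUTSIDE the kernel: that `make_plan` gives every ball a step and anchors only on graph
neighbours (bookkeeping), the re-anchoring intersection (l.334–366; an intersection of two valid
enclosures), the interval arithmetic itself (own `nextafter`-widened doubles), the `c`-pieces /
bisection cover of `[−1, 1]` and of the `t`-range, and the identification of the instance's map with
a configuration's tight graph (the enumeration premise shared by every instrument).
-/

noncomputable section

namespace Summit.Ventures.Crystal3D

open Matrix

/-! ## §1 Right-handed orthonormal frames; the gauge «first ball at the pole» -/

section Frames

/-- **Expansion in a right-handed orthonormal frame**: if `r₁, r₂` are orthonormal and
`r₃ = r₁ × r₂`, every `v` is `(r₁·v) r₁ + (r₂·v) r₂ + (r₃·v) r₃`. [folklore] -/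
theorem frame_expand {r₁ r₂ : Fin 3 → ℝ} (h1 : r₁ ⬝ᵥ r₁ = 1) (h2 : r₂ ⬝ᵥ r₂ = 1)
    (h12 : r₁ ⬝ᵥ r₂ = 0) (v : Fin 3 → ℝ) :
    v = (r₁ ⬝ᵥ v) • r₁ + (r₂ ⬝ᵥ v) • r₂ + ((r₁ ⨯₃ r₂) ⬝ᵥ v) • (r₁ ⨯₃ r₂) := by
  set n := r₁ ⨯₃ r₂ with hn
  have h21 : r₂ ⬝ᵥ r₁ = 0 := by rw [dotProduct_comm]; exact h12
  have hnn : n ⬝ᵥ n = 1 := by rw [hn, cross_dot_cross, h1, h2, h12, h21]; ring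
  set Z := v - (r₁ ⬝ᵥ v) • r₁ - (r₂ ⬝ᵥ v) • r₂ with hZ
  have hZ1 : Z ⬝ᵥ r₁ = 0 := by
    simp only [hZ, sub_dotProduct, smul_dotProduct, smul_eq_mul, h1, h21, dotProduct_comm v r₁]; ring
  have hZ2 : Z ⬝ᵥ r₂ = 0 := by
    simp only [hZ, sub_dotProduct, smul_dotProduct, smul_eq_mul, h2, h12, dotProduct_comm v r₂]; ring
  have hdec := smul_eq_smul_cross_of_perp hZ1 hZ2
  rw [← hn, hnn, one_smul] at hdec
  have hZn : Z ⬝ᵥ n = n ⬝ᵥ v := by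
    simp only [hZ, sub_dotProduct, smul_dotProduct, smul_eq_mul, hn, dot_self_cross, dot_cross_self,
      dotProduct_comm v]
    ring
  rw [hZn] at hdec
  have : v - (r₁ ⬝ᵥ v) • r₁ - (r₂ ⬝ᵥ v) • r₂ = (n ⬝ᵥ v) • n := hdec
  rw [← this]; abel

/-- **A frame map preserves dot products**: with `R v = (r₁·v, r₂·v, r₃·v)` for a right-handed
orthonormal frame, `R v · R w = v · w` — every row (E)(S) of every instrument is a dot product,
hence gauge-invariant. [folklore] -/
theorem frame_dot {r₁ r₂ : Fin 3 → ℝ} (h1 : r₁ ⬝ᵥ r₁ = 1) (h2 : r₂ ⬝ᵥ r₂ = 1)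
    (h12 : r₁ ⬝ᵥ r₂ = 0) (v w : Fin 3 → ℝ) :
    (![r₁ ⬝ᵥ v, r₂ ⬝ᵥ v, (r₁ ⨯₃ r₂) ⬝ᵥ v] : Fin 3 → ℝ) ⬝ᵥ ![r₁ ⬝ᵥ w, r₂ ⬝ᵥ w, (r₁ ⨯₃ r₂) ⬝ᵥ w] =
      v ⬝ᵥ w := by
  conv_rhs => rw [frame_expand h1 h2 h12 v]
  simp only [add_dotProduct, smul_dotProduct, smul_eq_mul, vec3_dotProduct]
  simp only [Matrix.cons_val_zero, Matrix.cons_val_one, Matrix.cons_val]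

/-- In a right-handed orthonormal frame `r₂ × r₃ = r₁` and `r₃ × r₁ = r₂` (`r₃ = r₁ × r₂`).
[folklore] -/
theorem frame_cyclic {r₁ r₂ : Fin 3 → ℝ} (h1 : r₁ ⬝ᵥ r₁ = 1) (h2 : r₂ ⬝ᵥ r₂ = 1)
    (h12 : r₁ ⬝ᵥ r₂ = 0) :
    r₂ ⨯₃ (r₁ ⨯₃ r₂) = r₁ ∧ (r₁ ⨯₃ r₂) ⨯₃ r₁ = r₂ := by
  have h21 : r₂ ⬝ᵥ r₁ = 0 := by rw [dotProduct_comm]; exact h12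
  constructor
  · rw [cross_cross_eq_smul_sub_smul', h2, h12, one_smul, zero_smul, sub_zero]
  · rw [cross_cross_eq_smul_sub_smul, h1, h21, one_smul, zero_smul, sub_zero]

/-- **A frame map commutes with the cross product** (it is a PROPER rotation): so every triple
product `det[x_v, x_a, x_b]` (rows (C), branch signs) is gauge-invariant. [folklore] -/
theorem frame_cross {r₁ r₂ : Fin 3 → ℝ} (h1 : r₁ ⬝ᵥ r₁ = 1) (h2 : r₂ ⬝ᵥ r₂ = 1)
    (h12 : r₁ ⬝ᵥ r₂ = 0) (v w : Fin 3 → ℝ) :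
    (![r₁ ⬝ᵥ v, r₂ ⬝ᵥ v, (r₁ ⨯₃ r₂) ⬝ᵥ v] : Fin 3 → ℝ) ⨯₃ ![r₁ ⬝ᵥ w, r₂ ⬝ᵥ w, (r₁ ⨯₃ r₂) ⬝ᵥ w] =
      ![r₁ ⬝ᵥ (v ⨯₃ w), r₂ ⬝ᵥ (v ⨯₃ w), (r₁ ⨯₃ r₂) ⬝ᵥ (v ⨯₃ w)] := by
  obtain ⟨hc1, hc2⟩ := frame_cyclic h1 h2 h12
  have e1 : r₁ ⬝ᵥ (v ⨯₃ w) = (r₂ ⬝ᵥ v) * ((r₁ ⨯₃ r₂) ⬝ᵥ w) - (r₂ ⬝ᵥ w) * ((r₁ ⨯₃ r₂) ⬝ᵥ v) := by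
    rw [← hc1, cross_dot_cross, hc1]
  have e2 : r₂ ⬝ᵥ (v ⨯₃ w) = ((r₁ ⨯₃ r₂) ⬝ᵥ v) * (r₁ ⬝ᵥ w) - ((r₁ ⨯₃ r₂) ⬝ᵥ w) * (r₁ ⬝ᵥ v) := by
    rw [← hc2, cross_dot_cross, hc2]
  have e3 : (r₁ ⨯₃ r₂) ⬝ᵥ (v ⨯₃ w) = (r₁ ⬝ᵥ v) * (r₂ ⬝ᵥ w) - (r₁ ⬝ᵥ w) * (r₂ ⬝ᵥ v) :=
    cross_dot_cross _ _ _ _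
  rw [cross_apply, e1, e2, e3]
  simp only [Matrix.cons_val_zero, Matrix.cons_val_one, Matrix.cons_val]
  ext i; fin_cases i <;> simp <;> ring

/-- Triple products are invariant under a frame map. [folklore] -/
theorem frame_triple {r₁ r₂ : Fin 3 → ℝ} (h1 : r₁ ⬝ᵥ r₁ = 1) (h2 : r₂ ⬝ᵥ r₂ = 1)
    (h12 : r₁ ⬝ᵥ r₂ = 0) (X a b : Fin 3 → ℝ) :
    (![r₁ ⬝ᵥ X, r₂ ⬝ᵥ X, (r₁ ⨯₃ r₂) ⬝ᵥ X] : Fin 3 → ℝ) ⬝ᵥ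
        ((![r₁ ⬝ᵥ a, r₂ ⬝ᵥ a, (r₁ ⨯₃ r₂) ⬝ᵥ a] : Fin 3 → ℝ) ⨯₃
          ![r₁ ⬝ᵥ b, r₂ ⬝ᵥ b, (r₁ ⨯₃ r₂) ⬝ᵥ b]) = X ⬝ᵥ (a ⨯₃ b) := by
  rw [frame_cross h1 h2 h12, frame_dot h1 h2 h12]

/-- **The gauge «first ball at the pole» exists**: every unit `u` is the third vector
`r₁ × r₂` of a right-handed orthonormal frame, so the frame map takes `u` to `(0, 0, 1)`
(fs4 kind 0 `P = (0,0,1)`; famcert's / LINK's `p = e₃`). [folklore] -/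
theorem gauge_pole {u : Fin 3 → ℝ} (hu : u ⬝ᵥ u = 1) :
    ∃ r₁ r₂ : Fin 3 → ℝ, r₁ ⬝ᵥ r₁ = 1 ∧ r₂ ⬝ᵥ r₂ = 1 ∧ r₁ ⬝ᵥ r₂ = 0 ∧ r₁ ⨯₃ r₂ = u ∧
      (![r₁ ⬝ᵥ u, r₂ ⬝ᵥ u, (r₁ ⨯₃ r₂) ⬝ᵥ u] : Fin 3 → ℝ) = ![0, 0, 1] := by
  -- a unit `e ⊥ u`: from `e_x` unless `u = ±e_x`, in which case `e_z` itself
  have key : ∃ e : Fin 3 → ℝ, e ⬝ᵥ e = 1 ∧ e ⬝ᵥ u = 0 := by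
    by_cases hx : (u 0) ^ 2 < 1
    · have he₀ : (![1, 0, 0] : Fin 3 → ℝ) ⬝ᵥ ![1, 0, 0] = 1 := by
        simp [dotProduct, Fin.sum_univ_three]
      have hg : ((![1, 0, 0] : Fin 3 → ℝ) ⬝ᵥ u) ^ 2 < 1 := by
        have : (![1, 0, 0] : Fin 3 → ℝ) ⬝ᵥ u = u 0 := by simp [dotProduct, Fin.sum_univ_three]
        rw [this]; exact hx
      obtain ⟨h1, h2, -⟩ := link_frame hu he₀ hg
      exact ⟨_, h1, h2⟩
    · have hu' : u 0 * u 0 + u 1 * u 1 + u 2 * u 2 = 1 := by rw [vec3_dotProduct] at hu; exact hu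
      have hz : u 2 = 0 := by nlinarith [sq_nonneg (u 1), sq_nonneg (u 2)]
      refine ⟨![0, 0, 1], by simp [dotProduct, Fin.sum_univ_three], ?_⟩
      simp [dotProduct, Fin.sum_univ_three, hz]
  obtain ⟨e, he, heu⟩ := key
  have hue : u ⬝ᵥ e = 0 := by rw [dotProduct_comm]; exact heu
  -- frame `r₁ = e`, `r₂ = u × e`, `r₁ × r₂ = u`
  have h3 : e ⨯₃ (u ⨯₃ e) = u := by
    rw [cross_cross_eq_smul_sub_smul', he, hue, one_smul, zero_smul, sub_zero]
  have h2 : (u ⨯₃ e) ⬝ᵥ (u ⨯₃ e) = 1 := by rw [cross_dot_cross, hu, he, hue, heu]; ring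
  have h12 : e ⬝ᵥ (u ⨯₃ e) = 0 := dot_cross_self u e
  have h2u : (u ⨯₃ e) ⬝ᵥ u = 0 := by rw [dotProduct_comm]; exact dot_self_cross u e
  refine ⟨e, u ⨯₃ e, he, h2, h12, h3, ?_⟩
  rw [h3, heu, h2u, hu]

/-- **fs4's gauge (kinds 0 and 1)**: unit `u₀, u₁` with `u₁·u₀ = t`, `t² < 1` are carried — by a
frame map (to put `u₀` at the pole) followed by a rotation about `e₃` — to `(0, 0, 1)` and
`(√(1 − t²), 0, t)` (l.325–329: `P = (0, 0, 1)`; `P = (SQ3H, 0, HALF)` for `t = 1/2`, else `(√(1−t²), 0, t)`); both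
maps preserve every dot product and every triple product (`frame_dot`, `frame_triple`,
`famcert_rotZ_dot`, `famcert_rotZ_triple`). [folklore] -/
theorem fs4_gauge {u₀ u₁ : Fin 3 → ℝ} (h0 : u₀ ⬝ᵥ u₀ = 1) (h1 : u₁ ⬝ᵥ u₁ = 1) {t : ℝ}
    (ht : u₁ ⬝ᵥ u₀ = t) (ht1 : t ^ 2 < 1) :
    ∃ r₁ r₂ : Fin 3 → ℝ, r₁ ⬝ᵥ r₁ = 1 ∧ r₂ ⬝ᵥ r₂ = 1 ∧ r₁ ⬝ᵥ r₂ = 0 ∧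
      (![r₁ ⬝ᵥ u₀, r₂ ⬝ᵥ u₀, (r₁ ⨯₃ r₂) ⬝ᵥ u₀] : Fin 3 → ℝ) = ![0, 0, 1] ∧
      ∃ φ : ℝ, (![Real.cos φ * (r₁ ⬝ᵥ u₁) - Real.sin φ * (r₂ ⬝ᵥ u₁),
          Real.sin φ * (r₁ ⬝ᵥ u₁) + Real.cos φ * (r₂ ⬝ᵥ u₁), (r₁ ⨯₃ r₂) ⬝ᵥ u₁] : Fin 3 → ℝ) =
        ![Real.sqrt (1 - t ^ 2), 0, t] := by
  obtain ⟨r₁, r₂, hr1, hr2, hr12, hr3, hpole⟩ := gauge_pole h0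
  refine ⟨r₁, r₂, hr1, hr2, hr12, hpole, ?_⟩
  set v : Fin 3 → ℝ := ![r₁ ⬝ᵥ u₁, r₂ ⬝ᵥ u₁, (r₁ ⨯₃ r₂) ⬝ᵥ u₁] with hv
  have hvv : v ⬝ᵥ v = 1 := by rw [hv, frame_dot hr1 hr2 hr12, h1]
  have hvz : v 2 = t := by
    have : v 2 = (r₁ ⨯₃ r₂) ⬝ᵥ u₁ := by simp [hv]
    rw [this, hr3, dotProduct_comm, ht]
  obtain ⟨φ, hφ⟩ := famcert_gauge ht1 hvz hvv
  refine ⟨φ, ?_⟩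
  have e0 : v 0 = r₁ ⬝ᵥ u₁ := by simp [hv]
  have e1 : v 1 = r₂ ⬝ᵥ u₁ := by simp [hv]
  have e2 : v 2 = (r₁ ⨯₃ r₂) ⬝ᵥ u₁ := by simp [hv]
  rw [e0, e1, e2] at hφ
  rw [hφ, ← hvz, e2]

end Frames

/-! ## §2 `trilat`: the two-anchored step and its clamps -/

section Trilat

/-- **fs4's x–x trilateration is exhaustive** (`trilat`, `ta = tb = HALF` branch, l.288–297:
`onep = 1 + μ`, `alpha = 0.5/onep`, `num = 1 + 2μ`, `den = 2·onep²·(1 − μ)`, `g2 = num/den`,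
`gam = ±√g2`, `P = alpha·(A + B) + gam·(A × B)`): unit anchors `A, B`, `μ = A·B`, `μ² < 1`; every
unit `P` tight to both (`P·A = P·B = 1/2`) is `alpha (A + B) + γ (A × B)` with
`γ² = (1 + 2μ)/(2(1+μ)²(1−μ))` — reached by one of the two branch signs. [folklore] -/
theorem fs4_trilat_xx {A B P : Fin 3 → ℝ} (hA : A ⬝ᵥ A = 1) (hB : B ⬝ᵥ B = 1)
    (hμ : (A ⬝ᵥ B) ^ 2 < 1) (h1 : P ⬝ᵥ A = 1 / 2) (h2 : P ⬝ᵥ B = 1 / 2) (hP : P ⬝ᵥ P = 1) :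
    ∃ γ : ℝ, P = (1 / (1 + A ⬝ᵥ B) * (1 / 2)) • (A + B) + γ • (A ⨯₃ B) ∧
      γ ^ 2 = (1 + 2 * (A ⬝ᵥ B)) / (2 * (1 + A ⬝ᵥ B) ^ 2 * (1 - A ⬝ᵥ B)) := by
  obtain ⟨C, hPeq, hC⟩ := link_TT_chart hA hB hμ h1 h2 hP
  set g := A ⬝ᵥ B with hg
  have hg1 : 1 + g ≠ 0 := by
    intro h; have : g = -1 := by linarith
    rw [this] at hμ; norm_num at hμ
  have hg2 : 1 - g ≠ 0 := by
    intro h; have : g = 1 := by linarith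
    rw [this] at hμ; norm_num at hμ
  refine ⟨C, ?_, ?_⟩
  · rw [hPeq]; congr 1; congr 1; field_simp
  · rw [eq_div_iff (by positivity), ← hC]

/-- **fs4's general trilateration is exhaustive** (`trilat` l.298–311: `omm = 1 − μ²`,
`alpha = (ta − μ·tb)/omm`, `beta = (tb − μ·ta)/omm`, `q = alpha² + beta² + 2·alpha·beta·μ`,
`g2 = (1 − q)/omm`, `gam = ±√g2`, `P = alpha·A + beta·B + gam·(A × B)`): unit anchors with
`μ² < 1` and a unit `P` at targets `P·A = t_a`, `P·B = t_b`; then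
`P = α A + β B + γ (A × B)` with `γ² = (1 − q)/(1 − μ²)`. [folklore] -/
theorem fs4_trilat {A B P : Fin 3 → ℝ} (hA : A ⬝ᵥ A = 1) (hB : B ⬝ᵥ B = 1)
    (hμ : (A ⬝ᵥ B) ^ 2 < 1) {ta tb : ℝ} (h1 : P ⬝ᵥ A = ta) (h2 : P ⬝ᵥ B = tb)
    (hP : P ⬝ᵥ P = 1) :
    ∃ γ : ℝ,
      P = ((ta - (A ⬝ᵥ B) * tb) / (1 - (A ⬝ᵥ B) ^ 2)) • A +
          ((tb - (A ⬝ᵥ B) * ta) / (1 - (A ⬝ᵥ B) ^ 2)) • B + γ • (A ⨯₃ B) ∧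
      γ ^ 2 = (1 - (((ta - (A ⬝ᵥ B) * tb) / (1 - (A ⬝ᵥ B) ^ 2)) ^ 2 +
          ((tb - (A ⬝ᵥ B) * ta) / (1 - (A ⬝ᵥ B) ^ 2)) ^ 2 +
          2 * ((ta - (A ⬝ᵥ B) * tb) / (1 - (A ⬝ᵥ B) ^ 2)) *
            ((tb - (A ⬝ᵥ B) * ta) / (1 - (A ⬝ᵥ B) ^ 2)) * (A ⬝ᵥ B))) / (1 - (A ⬝ᵥ B) ^ 2) := by
  obtain ⟨C, hPeq, hC⟩ := twoAnchor_chart hA hB hμ h1 h2 hP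
  have hden : 1 - (A ⬝ᵥ B) ^ 2 ≠ 0 := by
    have : 0 < 1 - (A ⬝ᵥ B) ^ 2 := by linarith
    exact this.ne'
  refine ⟨C, hPeq, ?_⟩
  rw [eq_div_iff hden, hC]; ring

/-- **fs4's x–x anchor clamp** (l.276–281: `if (mu.hi < -0.5) return 0; … mu.lo = max(mu.lo, −0.5)`,
«anchors > 120° apart: no common x-neighbour»): unit `A, B` with a common unit x-neighbour `P`
(`P·A = P·B = 1/2`) satisfy `−1/2 ≤ A·B` (the companion clamp `A·B ≤ 1/2` is the pair row).
[folklore] -/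
theorem fs4_clamp_xx {A B P : Fin 3 → ℝ} (hA : A ⬝ᵥ A = 1) (hB : B ⬝ᵥ B = 1)
    (h1 : P ⬝ᵥ A = 1 / 2) (h2 : P ⬝ᵥ B = 1 / 2) (hP : P ⬝ᵥ P = 1) : -(1 / 2 : ℝ) ≤ A ⬝ᵥ B := by
  by_cases hlt : A ⬝ᵥ B < 1
  · have hμ : (A ⬝ᵥ B) ^ 2 < 1 :=
      famcert_TRI_nondegenerate hA hB hlt (by rw [h1, h2]; norm_num)
    have h := famcert_twoCircle_test hA hB hμ h1 h2 hP
    nlinarith [h]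
  · linarith

/-- **fs4's p–x anchor clamp at the instance's hole level** (l.282–286 with l.712
`g_mulo_px = t·0.5 − √(1 − t²)·SQ3H`): if the hole direction `p` and a shell anchor `B` have a
common unit neighbour `P` with `P·p = t` (`t² < 1`) and `P·B = 1/2`, then
`t/2 − √(1 − t²)·(√3/2) ≤ p·B` (the two-circle test at levels `t`, `1/2`). [folklore] -/
theorem fs4_clamp_px {p B P : Fin 3 → ℝ} (hp : p ⬝ᵥ p = 1) (hB : B ⬝ᵥ B = 1) {t : ℝ}
    (ht : t ^ 2 < 1) (h1 : P ⬝ᵥ p = t) (h2 : P ⬝ᵥ B = 1 / 2) (hP : P ⬝ᵥ P = 1)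
    (hlt : p ⬝ᵥ B < 1) (hpos : 0 < t) :
    t / 2 - Real.sqrt (1 - t ^ 2) * (Real.sqrt 3 / 2) ≤ p ⬝ᵥ B := by
  have hμ : (p ⬝ᵥ B) ^ 2 < 1 :=
    famcert_TRI_nondegenerate hp hB hlt (by rw [h1, h2]; linarith)
  have h := (famcert_twoCircle_test' hp hB hμ ht.le h1 h2 hP).1
  rw [sqrt_one_sub_half_sq'] at h
  linarith

/-- **The p–x clamp is monotone in `t`**, so evaluating it at the cell's `t_lo` (as `fs4` does once
per run, l.712) is sound for every `t ∈ [t_lo, 1)`: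
`t_lo/2 − √(1 − t_lo²)·(√3/2) ≤ t/2 − √(1 − t²)·(√3/2)` for `0 ≤ t_lo ≤ t`. [folklore] -/
theorem fs4_clamp_px_mono {tlo t : ℝ} (h0 : 0 ≤ tlo) (hle : tlo ≤ t) :
    tlo / 2 - Real.sqrt (1 - tlo ^ 2) * (Real.sqrt 3 / 2) ≤
      t / 2 - Real.sqrt (1 - t ^ 2) * (Real.sqrt 3 / 2) := by
  have hs : Real.sqrt (1 - t ^ 2) ≤ Real.sqrt (1 - tlo ^ 2) :=
    Real.sqrt_le_sqrt (by nlinarith)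
  have h3 : 0 ≤ Real.sqrt 3 / 2 := by positivity
  nlinarith [mul_le_mul_of_nonneg_right hs h3]

end Trilat

/-! ## §3 The one-anchored step: the `ŷ` frame and the cosine-parametrised circle -/

section Circle

/-- **fs4's `ŷ` frame** (`frame()` l.251–253, used while `|A_y| < 0.8`: `C = (−A.z, 0, A.x)`
`= A × ŷ`, `nn = A.x² + A.z²`, `E1 = C/√nn`, `E2 = A × E1`): for `0 < A_x² + A_z²`, `E1` is a unit
vector orthogonal to `A`, and `A × ŷ = (−A_z, 0, A_x)`. (The `ẑ` frame of l.254–256,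
`(A_y, −A_x, 0)/√(A_x² + A_y²)`, is `famcert_ROT_frame`.) [folklore] -/
theorem fs4_frame_y {A : Fin 3 → ℝ} (hn : 0 < A 0 ^ 2 + A 2 ^ 2) :
    ((Real.sqrt (A 0 ^ 2 + A 2 ^ 2))⁻¹ • ![-(A 2), 0, A 0]) ⬝ᵥ
        ((Real.sqrt (A 0 ^ 2 + A 2 ^ 2))⁻¹ • ![-(A 2), 0, A 0]) = 1 ∧
      ((Real.sqrt (A 0 ^ 2 + A 2 ^ 2))⁻¹ • ![-(A 2), 0, A 0]) ⬝ᵥ A = 0 ∧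
      A ⨯₃ ![(0:ℝ), 1, 0] = ![-(A 2), 0, A 0] := by
  set q := Real.sqrt (A 0 ^ 2 + A 2 ^ 2) with hq
  have hq2 : q ^ 2 = A 0 ^ 2 + A 2 ^ 2 := Real.sq_sqrt hn.le
  have hq0 : q ≠ 0 := (Real.sqrt_pos.2 hn).ne'
  refine ⟨?_, ?_, ?_⟩
  · simp only [smul_dotProduct, dotProduct_smul, smul_eq_mul, vec3_dotProduct]
    simp only [Matrix.cons_val_zero, Matrix.cons_val_one, Matrix.cons_val]
    field_simp
    nlinarith [hq2]
  · simp only [smul_dotProduct, smul_eq_mul, vec3_dotProduct]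
    simp only [Matrix.cons_val_zero, Matrix.cons_val_one, Matrix.cons_val]
    ring
  · rw [cross_apply]; simp

/-- **fs4's one-anchored circle is exhaustive in the code's parametrisation** (kind 3, l.369–380:
`c = par ∈ [−1, 1]`, `s = ±√(1 − c²)` by the branch sign, `Q = c·E1 + s·E2`,
`P = t·A + √(1 − t²)·Q` (`= HALF·A + SQ3H·Q` for `t = 1/2`)): for a unit anchor `A`, a unit frame
vector `E1 ⊥ A` (either frame) and a unit `X` with `X·A = t`, `t² < 1`, there are `c ∈ [−1, 1]` and
a sign `ε = ±1` with `X = t A + √(1 − t²)(c E1 + ε√(1 − c²) (A × E1))`. [folklore] -/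
theorem fs4_circle_chart {A E1 X : Fin 3 → ℝ} (hA : A ⬝ᵥ A = 1) (hE : E1 ⬝ᵥ E1 = 1)
    (hEA : E1 ⬝ᵥ A = 0) {t : ℝ} (ht : t ^ 2 < 1) (hX : X ⬝ᵥ X = 1) (hXA : X ⬝ᵥ A = t) :
    ∃ c ε : ℝ, -1 ≤ c ∧ c ≤ 1 ∧ (ε = 1 ∨ ε = -1) ∧
      X = t • A + Real.sqrt (1 - t ^ 2) • (c • E1 + (ε * Real.sqrt (1 - c ^ 2)) • (A ⨯₃ E1)) := by
  obtain ⟨α, hα⟩ := oneAnchor_chart hA hE hEA ht hX hXA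
  refine ⟨Real.cos α, if 0 ≤ Real.sin α then 1 else -1, Real.neg_one_le_cos α, Real.cos_le_one α,
    ?_, ?_⟩
  · by_cases h : 0 ≤ Real.sin α <;> simp [h]
  · have hs : (if 0 ≤ Real.sin α then (1:ℝ) else -1) * Real.sqrt (1 - Real.cos α ^ 2) = Real.sin α := by
      rw [← Real.abs_sin_eq_sqrt_one_sub_cos_sq]
      by_cases h : 0 ≤ Real.sin α
      · rw [if_pos h, abs_of_nonneg h, one_mul]
      · rw [if_neg h, abs_of_neg (lt_of_not_ge h)]; ring
    rw [hs]; exact hα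

end Circle

end Summit.Ventures.Crystal3D
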